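import Summits.AtomisticToContinuum.HydrodynamicLimit.Theorems.CorrectorPressureDecay.Negative.Frame

/-!
# `CorrectorPressureDecay` — negative knowledge: the LD Mazur floor (correctors are blind on the invariant sector)

Support file for crux `stmt-AtomisticToContinuum-14135` (`AntiMazurCoboundaries.CorrectorPressureDecay`, "X"),
written by the standing disprover (cdisprove seat, cycle 2). Abstract measure-theoretic kernel of every floor in the
disproof file, dual to the route's thesis "coboundaries certify the ABSENCE of Drude weight from above":

* `tilted_jensen` — Jensen under the exponentially tilted law `μ.tilted V`:
  `(∫ e^V dμ) · exp(∫ (Y − V) d(μ.tilted V)) ≤ ∫ e^Y dμ` (the Gibbs/Donsker–Varadhan inequality tested on the tilt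
  by `V`; all functions bounded measurable, `μ` a probability measure).
* `measurePreserving_tilted` — tilting by a `T`-invariant potential keeps `T` measure-preserving.
* `integral_exp_le_integral_exp_sub_coboundary_of_invariant` — **LD Mazur floor, invariant-observable form**: if
  `F ∘ T = F` then for EVERY bounded measurable corrector `W` and every `s`,
  `∫ e^F dμ ≤ ∫ exp(F − s (W∘T − W)) dμ` — a coboundary cannot lower the exponential moment of an invariant
  observable (the tilted law `μ.tilted F` is `T`-invariant, so the coboundary has tilted mean `0`).
* `mul_exp_average_le_setIntegral_exp_sub_coboundary` — **invariant-event form** (the disprover's kill criterion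
  in checkable shape): for a `T`-invariant event `A` (`T ⁻¹' A = A`),
  `μ(A) · exp(μ(A)⁻¹ ∫_A F dμ) ≤ ∫_A exp(F − s (W∘T − W)) dμ`; so an invariant event of Gibbs mass `e^{-a(N+1)}` on
  which the flux observable averages `c(N+1)` with `2c − a > δ` defeats every corrector, whatever its cost
  (this is the mechanism of `correctorPressureDecay_false_without_amplitude`, there with the low-energy band).

All `[folklore]`; nothing here is specific to hard spheres.
-/

noncomputable section

open MeasureTheory ProbabilityTheory Set Filter Topology
open scoped ENNReal

namespace Summit.AtomisticToContinuum.HydrodynamicLimit.Theorems.CorrectorPressureDecayNegative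

variable {X : Type*} [MeasurableSpace X]

/-- Bounded measurable real functions have integrable exponentials on a finite measure space. [folklore] -/
theorem integrable_exp_of_abs_le {μ : Measure X} [IsFiniteMeasure μ] {V : X → ℝ} (hVm : Measurable V) {C : ℝ}
    (hV : ∀ x, |V x| ≤ C) : Integrable (fun x => Real.exp (V x)) μ := by
  refine (integrable_const (Real.exp C)).mono' (Real.continuous_exp.measurable.comp hVm).aestronglyMeasurable
    (ae_of_all _ fun x => ?_)
  rw [Real.norm_eq_abs, abs_of_pos (Real.exp_pos _)]
  exact Real.exp_le_exp.2 ((le_abs_self _).trans (hV x))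

/-- Bounded measurable real functions are integrable on a finite measure space. [folklore] -/
theorem integrable_of_abs_le {μ : Measure X} [IsFiniteMeasure μ] {V : X → ℝ} (hVm : Measurable V) {C : ℝ}
    (hV : ∀ x, |V x| ≤ C) : Integrable V μ :=
  (integrable_const C).mono' hVm.aestronglyMeasurable (ae_of_all _ fun x => by simpa [Real.norm_eq_abs] using hV x)

/-- **Jensen under the tilted law** (the Gibbs / Donsker–Varadhan inequality tested on an exponential tilt): for a
probability measure `μ` and bounded measurable `V, Y`,
`(∫ e^V dμ) · exp(∫ (Y − V) d(μ.tilted V)) ≤ ∫ e^Y dμ`. [folklore] -/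
theorem tilted_jensen {μ : Measure X} [IsProbabilityMeasure μ] {V Y : X → ℝ} (hVm : Measurable V)
    (hYm : Measurable Y) {CV CY : ℝ} (hV : ∀ x, |V x| ≤ CV) (hY : ∀ x, |Y x| ≤ CY) :
    (∫ x, Real.exp (V x) ∂μ) * Real.exp (∫ x, (Y x - V x) ∂(μ.tilted V)) ≤ ∫ x, Real.exp (Y x) ∂μ := by
  have hexpV : Integrable (fun x => Real.exp (V x)) μ := integrable_exp_of_abs_le hVm hV
  haveI : IsProbabilityMeasure (μ.tilted V) := isProbabilityMeasure_tilted hexpV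
  set Z : ℝ := ∫ x, Real.exp (V x) ∂μ with hZ
  have hZpos : 0 < Z := by
    rw [hZ]; exact integral_exp_pos hexpV
  have hD : ∀ x, |Y x - V x| ≤ CY + CV := fun x => (abs_sub _ _).trans (add_le_add (hY x) (hV x))
  have hDint : Integrable (fun x => Y x - V x) (μ.tilted V) := integrable_of_abs_le (hYm.sub hVm) hD
  have hexpDint : Integrable (fun x => Real.exp (Y x - V x)) (μ.tilted V) :=
    integrable_exp_of_abs_le (hYm.sub hVm) hD
  have hJ := ConvexOn.map_integral_le convexOn_exp Real.continuous_exp.continuousOn isClosed_univ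
    (ae_of_all _ fun x => mem_univ _) hDint hexpDint
  have hcomp : ∫ x, Real.exp (Y x - V x) ∂(μ.tilted V) = Z⁻¹ * ∫ x, Real.exp (Y x) ∂μ := by
    rw [integral_tilted]
    simp_rw [smul_eq_mul, ← hZ]
    rw [← integral_const_mul]
    refine integral_congr_ae (ae_of_all _ fun x => ?_)
    show Real.exp (V x) / Z * Real.exp (Y x - V x) = Z⁻¹ * Real.exp (Y x)
    rw [Real.exp_sub, div_eq_mul_inv, mul_comm (Real.exp (V x)) Z⁻¹, mul_assoc,
      mul_div_cancel₀ _ (Real.exp_pos _).ne']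
  rw [hcomp] at hJ
  have := mul_le_mul_of_nonneg_left hJ hZpos.le
  rwa [← mul_assoc, mul_inv_cancel₀ hZpos.ne', one_mul] at this

/-- Tilting by a `T`-invariant potential keeps `T` measure-preserving. [folklore] -/
theorem measurePreserving_tilted {μ : Measure X} {T : X → X} (hT : MeasurePreserving T μ μ)
    {V : X → ℝ} (hVm : Measurable V) (hinv : ∀ x, V (T x) = V x) :
    MeasurePreserving T (μ.tilted V) (μ.tilted V) := by
  refine ⟨hT.measurable, ?_⟩
  set ρ : X → ℝ≥0∞ := fun x => ENNReal.ofReal (Real.exp (V x) / ∫ x, Real.exp (V x) ∂μ) with hρ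
  have hρm : Measurable ρ := ((Real.continuous_exp.measurable.comp hVm).div_const _).ennreal_ofReal
  have htilt : μ.tilted V = μ.withDensity ρ := rfl
  ext A hA
  rw [Measure.map_apply hT.measurable hA, htilt, withDensity_apply _ (hT.measurable hA), withDensity_apply _ hA,
    ← lintegral_indicator (hT.measurable hA), ← lintegral_indicator hA]
  have : (fun x => (T ⁻¹' A).indicator ρ x) = fun x => (A.indicator ρ) (T x) := by
    funext x
    simp only [Set.indicator, mem_preimage, hρ, hinv]
    rfl
  rw [this, hT.lintegral_comp (hρm.indicator hA)]

/-- **LD Mazur floor, invariant-observable form.** If `F` is `T`-invariant (`μ` a `T`-invariant probability law)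
then NO coboundary corrector lowers its exponential moment: `∫ e^F dμ ≤ ∫ exp(F − s (W∘T − W)) dμ` for every
bounded measurable `W` and every `s` (Jensen under the `T`-invariant tilted law `μ.tilted F`, under which the
coboundary has mean zero). The charge side of Mazur's inequality at the exponential level: an invariant component
of the flux sets a floor under the crux's defect clause that no cost clause can see. [folklore] -/
theorem integral_exp_le_integral_exp_sub_coboundary_of_invariant {μ : Measure X} [IsProbabilityMeasure μ]
    {T : X → X} (hT : MeasurePreserving T μ μ) {F W : X → ℝ} (hFm : Measurable F) (hWm : Measurable W)
    {CF CW : ℝ} (hF : ∀ x, |F x| ≤ CF) (hW : ∀ x, |W x| ≤ CW) (hinv : ∀ x, F (T x) = F x) (s : ℝ) :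
    ∫ x, Real.exp (F x) ∂μ ≤ ∫ x, Real.exp (F x - s * (W (T x) - W x)) ∂μ := by
  have hYm : Measurable fun x => F x - s * (W (T x) - W x) :=
    hFm.sub (measurable_const.mul ((hWm.comp hT.measurable).sub hWm))
  have hY : ∀ x, |F x - s * (W (T x) - W x)| ≤ CF + |s| * (CW + CW) := by
    intro x
    calc |F x - s * (W (T x) - W x)| ≤ |F x| + |s * (W (T x) - W x)| := abs_sub _ _
      _ = |F x| + |s| * |W (T x) - W x| := by rw [abs_mul]
      _ ≤ CF + |s| * (CW + CW) := by
          gcongr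
          · exact hF x
          · exact (abs_sub _ _).trans (add_le_add (hW _) (hW _))
  have h := tilted_jensen (μ := μ) hFm hYm hF hY
  haveI : IsProbabilityMeasure (μ.tilted F) := isProbabilityMeasure_tilted (integrable_exp_of_abs_le hFm hF)
  have hTt : MeasurePreserving T (μ.tilted F) (μ.tilted F) := measurePreserving_tilted hT hFm hinv
  have hWint : Integrable W (μ.tilted F) := integrable_of_abs_le hWm hW
  have hWTint : Integrable (fun x => W (T x)) (μ.tilted F) :=
    integrable_of_abs_le (hWm.comp hT.measurable) fun x => hW (T x)
  have hWT : ∫ x, W (T x) ∂(μ.tilted F) = ∫ x, W x ∂(μ.tilted F) := by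
    rw [← integral_map hTt.measurable.aemeasurable hWm.aestronglyMeasurable, hTt.map_eq]
  have hmean : ∫ x, (F x - s * (W (T x) - W x) - F x) ∂(μ.tilted F) = 0 := by
    have : (fun x => F x - s * (W (T x) - W x) - F x) = fun x => -(s * (W (T x) - W x)) := by
      funext x; ring
    rw [this, integral_neg, integral_const_mul, integral_sub hWTint hWint, hWT, sub_self, mul_zero, neg_zero]
  rw [hmean, Real.exp_zero, mul_one] at h
  exact h

/-- **LD Mazur floor, invariant-event form** (the kill criterion): for a `T`-invariant probability law `μ`, a
`T`-invariant event `A` (`T ⁻¹' A = A`) of positive mass and bounded measurable `F, W`,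
`μ(A) · exp(μ(A)⁻¹ ∫_A F dμ) ≤ ∫_A exp(F − s (W∘T − W)) dμ`: restricted to an invariant event the corrector is a
coboundary of the normalised restricted (still invariant) law, so Jensen applies there. Consequently an invariant
event family of Gibbs mass `≥ e^{-a(N+1)}` on which the crux's `2F` averages `≥ b(N+1)` with `b − a > δ` refutes the
crux for that `δ`, for every lag, corrector and cost scale. [folklore] -/
theorem mul_exp_average_le_setIntegral_exp_sub_coboundary {μ : Measure X} [IsProbabilityMeasure μ]
    {T : X → X} (hT : MeasurePreserving T μ μ) {A : Set X} (hA : MeasurableSet A) (hTA : T ⁻¹' A = A)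
    (hμA : μ A ≠ 0) {F W : X → ℝ} (hFm : Measurable F) (hWm : Measurable W) {CF CW : ℝ}
    (hF : ∀ x, |F x| ≤ CF) (hW : ∀ x, |W x| ≤ CW) (s : ℝ) :
    (μ A).toReal * Real.exp ((μ A).toReal⁻¹ * ∫ x in A, F x ∂μ) ≤
      ∫ x in A, Real.exp (F x - s * (W (T x) - W x)) ∂μ := by
  -- the normalised restriction is a `T`-invariant probability law
  set ν : Measure X := (μ A)⁻¹ • μ.restrict A with hν
  have hμAtop : μ A ≠ ∞ := measure_ne_top μ A
  haveI : IsProbabilityMeasure ν := by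
    refine ⟨?_⟩
    rw [hν, Measure.smul_apply, Measure.restrict_apply_univ, smul_eq_mul, ENNReal.inv_mul_cancel hμA hμAtop]
  have hres : MeasurePreserving T (μ.restrict A) (μ.restrict A) := by
    refine ⟨hT.measurable, ?_⟩
    ext B hB
    rw [Measure.map_apply hT.measurable hB, Measure.restrict_apply (hT.measurable hB), Measure.restrict_apply hB,
      ← hT.measure_preimage (hB.inter hA).nullMeasurableSet, preimage_inter, hTA]
  have hTν : MeasurePreserving T ν ν := by
    refine ⟨hT.measurable, ?_⟩
    rw [hν, Measure.map_smul, hres.map_eq]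
  -- Jensen under `ν` with potential `0`
  have hYm : Measurable fun x => F x - s * (W (T x) - W x) :=
    hFm.sub (measurable_const.mul ((hWm.comp hT.measurable).sub hWm))
  have hY : ∀ x, |F x - s * (W (T x) - W x)| ≤ CF + |s| * (CW + CW) := by
    intro x
    calc |F x - s * (W (T x) - W x)| ≤ |F x| + |s * (W (T x) - W x)| := abs_sub _ _
      _ = |F x| + |s| * |W (T x) - W x| := by rw [abs_mul]
      _ ≤ CF + |s| * (CW + CW) := by
          gcongr
          · exact hF x
          · exact (abs_sub _ _).trans (add_le_add (hW _) (hW _))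
  have h := tilted_jensen (μ := ν) (V := fun _ => (0 : ℝ)) measurable_const hYm (CV := 0)
    (fun _ => by simp) hY
  have htc : ν.tilted (fun _ => (0 : ℝ)) = ν := tilted_const ν 0
  simp only [Real.exp_zero, integral_const, probReal_univ, one_smul, sub_zero, htc, one_mul] at h
  -- evaluate the `ν`-mean: the coboundary drops out, `F` averages to `μ(A)⁻¹ ∫_A F`
  have hWint : Integrable W ν := integrable_of_abs_le hWm hW
  have hWTint : Integrable (fun x => W (T x)) ν := integrable_of_abs_le (hWm.comp hT.measurable) fun x => hW (T x)
  have hFint : Integrable F ν := integrable_of_abs_le hFm hF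
  have hWT : ∫ x, W (T x) ∂ν = ∫ x, W x ∂ν := by
    rw [← integral_map hTν.measurable.aemeasurable hWm.aestronglyMeasurable, hTν.map_eq]
  have hmean : ∫ x, (F x - s * (W (T x) - W x)) ∂ν = (μ A).toReal⁻¹ * ∫ x in A, F x ∂μ := by
    have hI2 : Integrable (fun x => s * (W (T x) - W x)) ν := (hWTint.sub hWint).const_mul s
    have e1 : ∫ x, (F x - s * (W (T x) - W x)) ∂ν = (∫ x, F x ∂ν) - ∫ x, s * (W (T x) - W x) ∂ν :=
      integral_sub hFint hI2
    have e2 : ∫ x, s * (W (T x) - W x) ∂ν = s * ((∫ x, W (T x) ∂ν) - ∫ x, W x ∂ν) := by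
      rw [integral_const_mul, integral_sub hWTint hWint]
    rw [e1, e2, hWT, sub_self, mul_zero, sub_zero, hν, integral_smul_measure, ENNReal.toReal_inv, smul_eq_mul]
  have hrhs : ∫ x, Real.exp (F x - s * (W (T x) - W x)) ∂ν =
      (μ A).toReal⁻¹ * ∫ x in A, Real.exp (F x - s * (W (T x) - W x)) ∂μ := by
    rw [hν, integral_smul_measure, ENNReal.toReal_inv, smul_eq_mul]
  rw [hmean, hrhs] at h
  have hpos : 0 < (μ A).toReal := ENNReal.toReal_pos hμA hμAtop
  have := mul_le_mul_of_nonneg_left h hpos.le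
  rwa [← mul_assoc, mul_inv_cancel₀ hpos.ne', one_mul] at this

end Summit.AtomisticToContinuum.HydrodynamicLimit.Theorems.CorrectorPressureDecayNegative

end
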